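import Summits.BirchSwinnertonDyer.Rank1Residual.X11b.Three.JetchevShapeOverK
import HarnessLib

/-!
# X11b at every odd `p` and at `p = 3`, the JETCHEV road on the Tamagawa atom (T2′), file 2/2:
# the MONO-CARRIER sub-atom (all of `ord_p ∏c_ℓ(E)` at ONE bad prime `q`), where the reading
# `JET@p|N` of Jetchev's bound over `K` is exactly the missing upper half — class level
# (cell `b2b-bsdres`, team `x11b3` = N8/O2, seat p5, PLAN v1 §2 S5 · JET3N (c))

HONEST FRAMING (cell `b2b-bsdres`, run/shared/lean/b2b/bsd-rank1-residual/, verbatim in every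
file): the goal of the cell is to DELETE the COMBINATION-SHAPED residual classes of the
Birch–Swinnerton-Dyer formula for ALL analytic-rank `≤ 1` elliptic curves over `ℚ` — "full BSD
formula for every rank `≤ 1` curve in class `C`" assembled STRICTLY from published theorems — so
that the rank-`≤ 1` remainder becomes exactly the CONSTRUCTION-SHAPED classes, which are TYPED
(missing-input `Prop`s), NOT attempted. This is not "finishing BSD". Team `x11b3` is a RESEARCH
team; no claim beyond the stated class and sub-atom; X11b and X11 ∧ `r = 1` ∧ `p = 3` stay
CONSTRUCTION-SHAPED (REFEREE R6.2); §I O2 stays OPEN; nothing here is booked; census numbers quoted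
below are EVIDENCE pointers, never inputs. THEOREMS ONLY (no definition, no named fact, no `sorry`); the
one labelled hypothesis (the Jetchev shape over `K` at `p ∣ N`, written out in file 1/2
`Three/JetchevShapeOverK.lean` §1) enters every theorem as the explicit binder `hJ`.

## What this file does

Jetchev, Compos. Math. 144 (2008) p. 812: "If `p` divides at most one Tamagawa number, our upper
bound coincides with the exact upper bound predicted by the Birch and Swinnerton-Dyer conjectural
formula for `E/K`." In the cell's currency: on the **MONO-CARRIER sub-atom** of the Tamagawa atom
(T2′) = (ram) ∧ `p ∣ ∏c_ℓ` of class X11b — `ord_p ∏_ℓ c_ℓ(E) ≤ ord_p c_q(E)` for ONE prime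
`q ∣ N_E` (the shapes (T2α)/(T2β)/(T2γ)@3 of p3's `X11b/Three/TamagawaAtom.lean` say WHICH kind of
prime the carrier `q` is — `3` itself split with `3 ∣ ord_3 Δ`, a split multiplicative `ℓ ≠ 3`, or
an additive IV/IV* place with `c = 3` —; this file does not care) — the Jetchev-shape bound over
`K` READ at `p ∥ N` (hypothesis `hJ`, `[claim: Jetchev2008, status: under-review]`, the lane's flag
`JET@p|N`) IS the whole missing upper half:

* §3 `missingUpperBoundAt_of_classX11b_of_ram_of_monoCarrier` (every odd `p`): nine PUBLISHED facts
  of multr1-p2's odd-prime chain (`hGZ hKo hSk hGZK hmod hnf hHL hMaz hNS` — Kolyvagin's Thm. A `hB`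
  is replaced by the binder `hJ`) ⇒ `ClassX11b W p → Ram W p → (q ∣ N_E, ord_p ∏c ≤ ord_p c_q) →
  Typed.MissingUpperBoundAt W p`; with STEP L (route p2's typed input `IndexLowerBoundAt`, OPEN at
  `p ∥ N`) full `BSD(E,p)`: `bsdp_of_classX11b_of_ram_of_monoCarrier` — the pair is then in the SAME
  position as an atom-A1 pair (`bsdp_of_classX11b_of_ram_of_not_dvd`) up to the tier of `JET@p|N`,
  and NO (T2′) input proper (route p2's `hU`, the Shimura road of S2b, the additive carrier of S2c)
  is used; `padicValNat_shaOrder_le_add_sub_of_classX11b_of_ram` records what the reading buys OFF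
  the sub-atom: Kolyvagin's defect `2·ord_p ∏c_ℓ` minus `2·ord_p c_q` for the best `q` — on a pair
  with two carriers `p ∥ c_{q₁}, c_{q₂}` a defect `2` remains and the (T2′) input is still needed;
* §4 the `p = 3` rows in the vocabulary of the typed class `IsX11Three` (`mult(3) ∧ irr(3) ∧ r = 1`)
  and of `ClassX11b W 3` (for p3's whole-class assembly `Three/TamagawaAtomClass.lean`, whose
  (T2α/β/γ)@3 upper binders the reading replaces on mono-carrier pairs).

Sub-population BY NAME (REFEREE §1 A1): X11b@p ∧ (ram) ∧ [∃ prime `q ∣ N_E`,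
`ord_p ∏_ℓ c_ℓ(E) ≤ ord_p c_q(E)`] (⊇ atom A1, where any bad `q` works). EVIDENCE pointer (seat
census, two engines, nothing booked; HOME/b2b-bsdres-x11b3-p5/S5C-EVIDENCE-mono.md): the count of
mono-carrier pairs among the 123 739 (T2′)@3 atom pairs of census3 (`N < 5·10⁵`), by kind of
carrier, and among the lane's 568 true-open (T2′)@3 cells. CONDITIONAL on the reading (and on STEP L
for `BSD(E,p)`); nothing is booked; no tier or label moves (referee A's call); O2 OPEN.

References: [Jetchev2008] Thm. 1.1, Hypothesis (∗) (Compos. Math. 144 (2008) p. 812);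
[JetchevSkinnerWan2017] §7.4.1–7.4.3 (pp. 30–31), p. 4 ("at most one Tamagawa number");
[Skinner2016PacificMC] Thm. C and footnote 1; [HoffsteinLuo1997] Theorem (§1); [Mazur1978] Cor. 4.1;
[Serre1972] Prop. 15; [Miller2011LMS] Def. 1.1; cell files `X11b/BDPRouteOddPrimeClass.lean`,
`Three/JetchevShapeOverK.lean`, `Three/TamagawaAtom*.lean`, `Three/TamagawaAtomSelmerCertificate.lean`.
-/

noncomputable section

open scoped Classical

open WeierstrassCurve NumberField Literature.NumberTheory.EllipticCurves
  Literature.NumberTheory.EllipticCurves.ModularForms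
  Literature.NumberTheory.EllipticCurves.Rank1Residual

namespace Summit.BirchSwinnertonDyer.Rank1Residual.X11b

/-! ### §3. Class level, every odd prime: the mono-carrier sub-atom of (T2′) -/

/-- **The Euler-system half of `BSD(E,p)` on X11b ∧ (ram) ∧ MONO-CARRIER, from the Jetchev-shape
binder over `K` read at `p ∥ N` — every odd prime.** For every `(E,p)` in X11b (`r_an = 1`, `p` odd,
multiplicative at `p`, `E[p]` irreducible) with a (ram) prime and ONE prime `q ∣ N_E` absorbing the
whole `p`-part of the Tamagawa product (`ord_p ∏_ℓ c_ℓ(E) ≤ ord_p c_q(E)`; on atom A1 any bad `q`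
will do, so this CONTAINS multr1-p2's `missingUpperBoundAt_of_classX11b_of_ram_of_not_dvd` modulo
the binder): `ord_p #Ш(E) ≤ ord_p #Ш(E)_an` (`Typed.MissingUpperBoundAt W p`). Inputs: the nine
PUBLISHED named facts of multr1-p2's odd-prime chain — Gross–Zagier (`hGZ`), Kolyvagin qualitative
(`hKo`), Skinner 2016 Thm. C (`hSk`, for the Hoffstein–Luo twist), Gross–Zagier–Kolyvagin over `ℚ`
(`hGZK`), modularity (`hmod`, `hnf`), Hoffstein–Luo 1997 (`hHL`), Mazur 1978 Cor. 4.1 (`hMaz`),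
Néron mapping property (`hNS`) — and the ONE LABELLED hypothesis `hJ` (Jetchev shape over `K` at `p ∣ N`) at every
level/curve/field (in place of Kolyvagin's Thm. A `hB`; `ρ̄_{E,p}` onto by `surj_of_irr_of_ram`,
`p ∣ N_E` by multiplicativity). CONDITIONAL on the reading `JET@p|N`; nothing booked; labels
unchanged. [claim: Jetchev2008, status: under-review]
[cite: Jetchev2008, Thm. 1.1 (p. 812) (shape only)] [cite: JetchevSkinnerWan2017, §7.4.2 (p. 31)]
[cite: Skinner2016PacificMC, Thm. C (§1) and footnote 1] [cite: HoffsteinLuo1997, Theorem (§1)]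
[cite: Mazur1978, Cor. 4.1] [cite: Miller2011LMS, Def. 1.1] -/
theorem missingUpperBoundAt_of_classX11b_of_ram_of_monoCarrier (p : ℕ) [Fact p.Prime]
    -- published inputs (named facts of the tree)
    (hGZ : ∀ (N : ℕ) [NeZero N] (W : WeierstrassCurve ℚ) (K : Type) [Field K] [NumberField K],
      gross_zagier N W K)
    (hKo : ∀ (N : ℕ) [NeZero N] (W : WeierstrassCurve ℚ) (K : Type) [Field K] [NumberField K],
      kolyvagin N W K)
    (hSk : Skinner2016.thmC_padicValRat_bsd_rank_zero)
    (hGZK : rank_eq_analyticRank_of_analyticRank_le_one) (hmod : hasEntireLFunction_rat)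
    (hnf : exists_isNewformOf) (hHL : HoffsteinLuo1997_exists_twist_L_one_ne_zero)
    (hMaz : mazur_not_dvd_maninConstant_of_odd) (hNS : integral_neronScaling_of_isGloballyMinimal)
    -- the ONE labelled binder (reading `JET@p|N`), at every level / curve / field
    (hJ : ∀ (N : ℕ) [NeZero N] (W : WeierstrassCurve ℚ) [W.IsElliptic] (K : Type) [Field K]
      [NumberField K], IsImaginaryQuadratic K → SatisfiesHeegnerHypothesis N K →
      ∀ {P : (W.baseChange K).toAffine.Point}, IsHeegnerPoint N W K P → ¬ IsOfFinAddOrder P →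
      p ∣ N → W.HasSurjectiveModNGaloisRep p → ∀ (q : ℕ) [Fact q.Prime], q ∣ N →
      padicValNat p (Nat.card (W.baseChange K).sha) +
          2 * padicValNat p ((W.baseChange ℚ_[q]).localTamagawaNumber ℤ_[q]) ≤
        2 * padicValNat p (AddSubgroup.zmultiples P).index) :
    ∀ (W : WeierstrassCurve ℚ) [W.IsElliptic] [W.IsGloballyMinimal],
      ClassX11b W p → Ram W p →
      ∀ (q : ℕ) [Fact q.Prime], q ∣ W.conductorNorm ℤ →
        padicValNat p W.tamagawaProduct ≤
          padicValNat p ((W.baseChange ℚ_[q]).localTamagawaNumber ℤ_[q]) →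
        Typed.MissingUpperBoundAt W p := by
  intro W _ _ hX hram q _ hqN hmono
  have hp : p.Prime := Fact.out
  obtain ⟨hr, hp2, hmult, hirr⟩ := hX
  haveI : NeZero (W.conductorNorm ℤ) := ⟨(W.conductorNorm_pos_holds).ne'⟩
  obtain ⟨K, _, _, Dt, H, ι, P, Wd, _, _, Cd, hK, hodd, hpd, hHN, hP, hc, hμ, hLt, hWd⟩ :=
    exists_oddHeegnerData hnf hHL hMaz hNS W p hr hp2 hmult hirr
  -- `ρ̄_{E,p}` surjective from irr + ram; `p ∣ N_E` from multiplicative reduction at `p`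
  have hsurj : Surj W p := surj_of_irr_of_ram W p hirr hram
  have hpN : p ∣ W.conductorNorm ℤ :=
    (W.dvd_conductorNorm_iff_not_hasGoodReductionAtPrime p).mpr
      (WeierstrassCurve.HasMultiplicativeReduction.not_hasGoodReduction (R := ℤ_[p]) hmult)
  have hU : Finite (W.baseChange K).sha → ¬ IsOfFinAddOrder P →
      padicValNat p (Nat.card (W.baseChange K).sha) +
          2 * padicValNat p ((W.baseChange ℚ_[q]).localTamagawaNumber ℤ_[q]) ≤
        2 * padicValNat p (AddSubgroup.zmultiples P).index :=
    fun _ hnt ↦ hJ _ W K hK hHN ⟨Dt, H, ι, hP⟩ hnt hpN hsurj q hqN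
  exact (sharp_of_heegnerData_of_odd W p K Dt H ι P (hGZ _ W K) (hKo _ W K) hSk hGZK hmod hr hp2
    hmult hirr hram hK hodd hpd hHN hP hc hμ hLt Wd Cd hWd hU).2 hmono

/-- **Full `BSD(E,p)` from STEP L on X11b ∧ (ram) ∧ MONO-CARRIER, modulo the reading `JET@p|N` —
every odd prime.** Upper half: `missingUpperBoundAt_of_classX11b_of_ram_of_monoCarrier` (nine
published facts + the labelled binder `hJ`); lower half: multr1-p2's
`missingLowerBoundAt_of_classX11b_of_ram_odd` from STEP L (`hL`: route p2's typed input
`IndexLowerBoundAt`, OPEN at `p ∥ N`, at every Manin-good Heegner datum of X11b ∧ (ram) pairs);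
recombined by `bsdp_of_halves`. On this sub-atom the pair is therefore in the SAME position as an
atom-A1 pair (`bsdp_of_classX11b_of_ram_of_not_dvd`) up to the tier of `JET@p|N`: no (T2′) input
proper is used. CONDITIONAL on STEP L and on the reading; nothing booked; labels unchanged.
[claim: Jetchev2008, status: under-review]
[cite: JetchevSkinnerWan2017, §7.4.1–7.4.3 (pp. 30–31)] [cite: Jetchev2008, Thm. 1.1 (shape only)]
[cite: Miller2011LMS, Def. 1.1] -/
theorem bsdp_of_classX11b_of_ram_of_monoCarrier (p : ℕ) [Fact p.Prime]
    -- published inputs (named facts of the tree)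
    (hGZ : ∀ (N : ℕ) [NeZero N] (W : WeierstrassCurve ℚ) (K : Type) [Field K] [NumberField K],
      gross_zagier N W K)
    (hKo : ∀ (N : ℕ) [NeZero N] (W : WeierstrassCurve ℚ) (K : Type) [Field K] [NumberField K],
      kolyvagin N W K)
    (hSk : Skinner2016.thmC_padicValRat_bsd_rank_zero)
    (hGZK : rank_eq_analyticRank_of_analyticRank_le_one) (hmod : hasEntireLFunction_rat)
    (hnf : exists_isNewformOf) (hHL : HoffsteinLuo1997_exists_twist_L_one_ne_zero)
    (hMaz : mazur_not_dvd_maninConstant_of_odd) (hNS : integral_neronScaling_of_isGloballyMinimal)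
    -- the ONE labelled binder (reading `JET@p|N`)
    (hJ : ∀ (N : ℕ) [NeZero N] (W : WeierstrassCurve ℚ) [W.IsElliptic] (K : Type) [Field K]
      [NumberField K], IsImaginaryQuadratic K → SatisfiesHeegnerHypothesis N K →
      ∀ {P : (W.baseChange K).toAffine.Point}, IsHeegnerPoint N W K P → ¬ IsOfFinAddOrder P →
      p ∣ N → W.HasSurjectiveModNGaloisRep p → ∀ (q : ℕ) [Fact q.Prime], q ∣ N →
      padicValNat p (Nat.card (W.baseChange K).sha) +
          2 * padicValNat p ((W.baseChange ℚ_[q]).localTamagawaNumber ℤ_[q]) ≤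
        2 * padicValNat p (AddSubgroup.zmultiples P).index)
    -- the typed input of route p2 (STEP L), at every Heegner datum with Manin constant prime to `p`
    (hL : ∀ (W : WeierstrassCurve ℚ) [W.IsElliptic] [W.IsGloballyMinimal] (p : ℕ) [Fact p.Prime]
      (N : ℕ) [NeZero N] (K : Type) [Field K] [NumberField K]
      (Dt : ModularParametrizationData W N) (H : HeegnerDatum N (NumberField.discr K)) (ι : K →+* ℂ)
      (P : (W.baseChange K).toAffine.Point),
      ClassX11b W p → Ram W p → W.conductorNorm ℤ = N → IsImaginaryQuadratic K →
      SatisfiesHeegnerHypothesis N K →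
      WeierstrassCurve.Affine.Point.map ι.toRatAlgHom P = heegnerPointComplex Dt H →
      ¬ (p : ℤ) ∣ Dt.c → IndexLowerBoundAt W p K P) :
    ∀ (W : WeierstrassCurve ℚ) [W.IsElliptic] [W.IsGloballyMinimal],
      ClassX11b W p → Ram W p →
      ∀ (q : ℕ) [Fact q.Prime], q ∣ W.conductorNorm ℤ →
        padicValNat p W.tamagawaProduct ≤
          padicValNat p ((W.baseChange ℚ_[q]).localTamagawaNumber ℤ_[q]) →
        BSDp W p := by
  intro W _ _ hX hram q _ hqN hmono
  exact bsdp_of_halves hGZK W p (le_of_eq hX.1)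
    (missingLowerBoundAt_of_classX11b_of_ram_odd hGZ hKo hSk hGZK hmod hnf hHL hMaz hNS hL W p hX hram)
    (missingUpperBoundAt_of_classX11b_of_ram_of_monoCarrier p hGZ hKo hSk hGZK hmod hnf hHL hMaz hNS
      hJ W hX hram q hqN hmono)

/-- **Jetchev's residual Tamagawa defect on X11b ∧ (ram), class level, every odd prime** (what the
reading `JET@p|N` buys OFF the mono-carrier sub-atom). For every `(E,p)` in X11b with a (ram) prime
and every prime `q ∣ N_E`: `#Ш(E)_an` is a rational `r` with
`ord_p #Ш(E) + 2·ord_p c_q(E) ≤ ord_p r + 2·ord_p ∏_ℓ c_ℓ(E)` — Kolyvagin's defect `2·ord_p ∏c_ℓ`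
(multr1-p2's `padicValNat_shaOrder_le_add_of_classX11b_of_ram_odd`, published facts only) reduced by
`2·ord_p c_q` for the best `q`, modulo the binder. On a pair with two carriers `q₁ ≠ q₂`,
`p ∥ c_{q₁}, c_{q₂}`, this leaves `ord_p #Ш(E) ≤ ord_p #Ш(E)_an + 2` and nothing better: there the
(T2′) input proper is still needed. CONDITIONAL on the reading; nothing booked.
[claim: Jetchev2008, status: under-review]
[cite: Jetchev2008, Thm. 1.1 (p. 812) (shape only)] [cite: JetchevSkinnerWan2017, §7.4.2 (p. 31)]
[cite: Miller2011LMS, Def. 1.1] -/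
theorem padicValNat_shaOrder_le_add_sub_of_classX11b_of_ram (p : ℕ) [Fact p.Prime]
    -- published inputs (named facts of the tree)
    (hGZ : ∀ (N : ℕ) [NeZero N] (W : WeierstrassCurve ℚ) (K : Type) [Field K] [NumberField K],
      gross_zagier N W K)
    (hKo : ∀ (N : ℕ) [NeZero N] (W : WeierstrassCurve ℚ) (K : Type) [Field K] [NumberField K],
      kolyvagin N W K)
    (hSk : Skinner2016.thmC_padicValRat_bsd_rank_zero)
    (hGZK : rank_eq_analyticRank_of_analyticRank_le_one) (hmod : hasEntireLFunction_rat)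
    (hnf : exists_isNewformOf) (hHL : HoffsteinLuo1997_exists_twist_L_one_ne_zero)
    (hMaz : mazur_not_dvd_maninConstant_of_odd) (hNS : integral_neronScaling_of_isGloballyMinimal)
    -- the ONE labelled binder (reading `JET@p|N`)
    (hJ : ∀ (N : ℕ) [NeZero N] (W : WeierstrassCurve ℚ) [W.IsElliptic] (K : Type) [Field K]
      [NumberField K], IsImaginaryQuadratic K → SatisfiesHeegnerHypothesis N K →
      ∀ {P : (W.baseChange K).toAffine.Point}, IsHeegnerPoint N W K P → ¬ IsOfFinAddOrder P →
      p ∣ N → W.HasSurjectiveModNGaloisRep p → ∀ (q : ℕ) [Fact q.Prime], q ∣ N →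
      padicValNat p (Nat.card (W.baseChange K).sha) +
          2 * padicValNat p ((W.baseChange ℚ_[q]).localTamagawaNumber ℤ_[q]) ≤
        2 * padicValNat p (AddSubgroup.zmultiples P).index) :
    ∀ (W : WeierstrassCurve ℚ) [W.IsElliptic] [W.IsGloballyMinimal],
      ClassX11b W p → Ram W p →
      ∀ (q : ℕ) [Fact q.Prime], q ∣ W.conductorNorm ℤ →
        ∃ r : ℚ, shaAn W = (r : ℂ) ∧
          (padicValNat p W.shaOrder : ℤ) +
              2 * padicValNat p ((W.baseChange ℚ_[q]).localTamagawaNumber ℤ_[q]) ≤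
            padicValRat p r + 2 * padicValNat p W.tamagawaProduct := by
  intro W _ _ hX hram q _ hqN
  have hp : p.Prime := Fact.out
  obtain ⟨hr, hp2, hmult, hirr⟩ := hX
  haveI : NeZero (W.conductorNorm ℤ) := ⟨(W.conductorNorm_pos_holds).ne'⟩
  obtain ⟨K, _, _, Dt, H, ι, P, Wd, _, _, Cd, hK, hodd, hpd, hHN, hP, hc, hμ, hLt, hWd⟩ :=
    exists_oddHeegnerData hnf hHL hMaz hNS W p hr hp2 hmult hirr
  have hsurj : Surj W p := surj_of_irr_of_ram W p hirr hram
  have hpN : p ∣ W.conductorNorm ℤ :=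
    (W.dvd_conductorNorm_iff_not_hasGoodReductionAtPrime p).mpr
      (WeierstrassCurve.HasMultiplicativeReduction.not_hasGoodReduction (R := ℤ_[p]) hmult)
  have hU : Finite (W.baseChange K).sha → ¬ IsOfFinAddOrder P →
      padicValNat p (Nat.card (W.baseChange K).sha) +
          2 * padicValNat p ((W.baseChange ℚ_[q]).localTamagawaNumber ℤ_[q]) ≤
        2 * padicValNat p (AddSubgroup.zmultiples P).index :=
    fun _ hnt ↦ hJ _ W K hK hHN ⟨Dt, H, ι, hP⟩ hnt hpN hsurj q hqN
  exact (sharp_of_heegnerData_of_odd W p K Dt H ι P (hGZ _ W K) (hKo _ W K) hSk hGZK hmod hr hp2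
    hmult hirr hram hK hodd hpd hHN hP hc hμ hLt Wd Cd hWd hU).1

/-! ### §4. `p = 3`, in the vocabulary of the typed class `IsX11Three` (team `x11b3`, N8/O2) -/

namespace Three

/-- **X11b at `p = 3`, rank one (`IsX11Three`), with a (ram) prime, on the MONO-CARRIER sub-atom of
(T2′)@3: the Euler-system half `ord_3 #Ш(E) ≤ ord_3 #Ш(E)_an` from the nine published facts and
the reading `JET@3|N` alone.** Sub-population BY NAME: `IsX11Three W ∧ Ram W 3 ∧
(∃ prime q ∣ N_E, ord_3 ∏_ℓ c_ℓ(E) ≤ ord_3 c_q(E))` — the carrier `q` is `3` itself ((T2α)@3: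
split at `3`, `3 ∣ ord_3 Δ`), a split multiplicative `ℓ ≠ 3` ((T2β)@3) or an additive place of
Kodaira type IV/IV* with `c = 3` ((T2γ)@3), indifferently (`X11b/Three/TamagawaAtom.lean`); on A1
(`3 ∤ ∏c`) the hypothesis is vacuous in `q`. The typed missing input of `Typed/X11Three.lean` for
these pairs is thereby HALVED modulo the reading: what remains is STEP L at `3`. Nothing booked;
label unchanged (CONSTRUCTION-SHAPED); O2 OPEN.
[claim: Jetchev2008, status: under-review]
[cite: Jetchev2008, Thm. 1.1 (p. 812) (shape only)] [cite: Skinner2016PacificMC, Thm. C (§1) and footnote 1]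
[cite: HoffsteinLuo1997, Theorem (§1)] [cite: Miller2011LMS, Def. 1.1] -/
theorem IsX11Three.missingUpperBoundAt_of_ram_of_monoCarrier
    -- published inputs (named facts of the tree)
    (hGZ : ∀ (N : ℕ) [NeZero N] (W : WeierstrassCurve ℚ) (K : Type) [Field K] [NumberField K],
      gross_zagier N W K)
    (hKo : ∀ (N : ℕ) [NeZero N] (W : WeierstrassCurve ℚ) (K : Type) [Field K] [NumberField K],
      kolyvagin N W K)
    (hSk : Skinner2016.thmC_padicValRat_bsd_rank_zero)
    (hGZK : rank_eq_analyticRank_of_analyticRank_le_one) (hmod : hasEntireLFunction_rat)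
    (hnf : exists_isNewformOf) (hHL : HoffsteinLuo1997_exists_twist_L_one_ne_zero)
    (hMaz : mazur_not_dvd_maninConstant_of_odd) (hNS : integral_neronScaling_of_isGloballyMinimal)
    -- the ONE labelled binder (reading `JET@3|N`)
    (hJ : ∀ (N : ℕ) [NeZero N] (W : WeierstrassCurve ℚ) [W.IsElliptic] (K : Type) [Field K]
      [NumberField K], IsImaginaryQuadratic K → SatisfiesHeegnerHypothesis N K →
      ∀ {P : (W.baseChange K).toAffine.Point}, IsHeegnerPoint N W K P → ¬ IsOfFinAddOrder P →
      3 ∣ N → W.HasSurjectiveModNGaloisRep 3 → ∀ (q : ℕ) [Fact q.Prime], q ∣ N →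
      padicValNat 3 (Nat.card (W.baseChange K).sha) +
          2 * padicValNat 3 ((W.baseChange ℚ_[q]).localTamagawaNumber ℤ_[q]) ≤
        2 * padicValNat 3 (AddSubgroup.zmultiples P).index)
    (W : WeierstrassCurve ℚ) [W.IsElliptic] [W.IsGloballyMinimal] (hX : IsX11Three W)
    (hram : Ram W 3) (q : ℕ) [Fact q.Prime] (hqN : q ∣ W.conductorNorm ℤ)
    (hmono : padicValNat 3 W.tamagawaProduct ≤
      padicValNat 3 ((W.baseChange ℚ_[q]).localTamagawaNumber ℤ_[q])) :
    Typed.MissingUpperBoundAt W 3 :=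
  haveI : Fact (Nat.Prime 3) := ⟨by norm_num⟩
  missingUpperBoundAt_of_classX11b_of_ram_of_monoCarrier 3 hGZ hKo hSk hGZK hmod hnf hHL hMaz hNS hJ W
    (classX11b_three_of_isX11Three W hX) hram q hqN hmono

/-- **X11b at `p = 3`, rank one, (ram), MONO-CARRIER: `BSD(E,3)` from STEP L at `3` and the reading
`JET@3|N`** (route p2's typed input `IndexLowerBoundAt` at the Manin-good Heegner data of X11b ∧
(ram) pairs — the statement the team's S0 `X11b.Three.StepLAt` / multr1-p2's
`P2OpenInputOnTreeOddAt W 3` feed through `X11b/BDPRouteOnTreeStepL.lean` — and the labelled binder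
`hJ`). Same sub-population as `IsX11Three.missingUpperBoundAt_of_ram_of_monoCarrier`. CONDITIONAL on
both; nothing booked; label unchanged; O2 OPEN.
[claim: Jetchev2008, status: under-review]
[cite: JetchevSkinnerWan2017, §7.4.1–7.4.3 (pp. 30–31)] [cite: Miller2011LMS, Def. 1.1] -/
theorem IsX11Three.bsdp_of_ram_of_monoCarrier_of_indexLowerBoundAt
    -- published inputs (named facts of the tree)
    (hGZ : ∀ (N : ℕ) [NeZero N] (W : WeierstrassCurve ℚ) (K : Type) [Field K] [NumberField K],
      gross_zagier N W K)
    (hKo : ∀ (N : ℕ) [NeZero N] (W : WeierstrassCurve ℚ) (K : Type) [Field K] [NumberField K],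
      kolyvagin N W K)
    (hSk : Skinner2016.thmC_padicValRat_bsd_rank_zero)
    (hGZK : rank_eq_analyticRank_of_analyticRank_le_one) (hmod : hasEntireLFunction_rat)
    (hnf : exists_isNewformOf) (hHL : HoffsteinLuo1997_exists_twist_L_one_ne_zero)
    (hMaz : mazur_not_dvd_maninConstant_of_odd) (hNS : integral_neronScaling_of_isGloballyMinimal)
    -- the ONE labelled binder (reading `JET@3|N`)
    (hJ : ∀ (N : ℕ) [NeZero N] (W : WeierstrassCurve ℚ) [W.IsElliptic] (K : Type) [Field K]
      [NumberField K], IsImaginaryQuadratic K → SatisfiesHeegnerHypothesis N K →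
      ∀ {P : (W.baseChange K).toAffine.Point}, IsHeegnerPoint N W K P → ¬ IsOfFinAddOrder P →
      3 ∣ N → W.HasSurjectiveModNGaloisRep 3 → ∀ (q : ℕ) [Fact q.Prime], q ∣ N →
      padicValNat 3 (Nat.card (W.baseChange K).sha) +
          2 * padicValNat 3 ((W.baseChange ℚ_[q]).localTamagawaNumber ℤ_[q]) ≤
        2 * padicValNat 3 (AddSubgroup.zmultiples P).index)
    -- STEP L (route p2's typed input, OPEN at `3 ∥ N`)
    (hL : ∀ (W : WeierstrassCurve ℚ) [W.IsElliptic] [W.IsGloballyMinimal] (p : ℕ) [Fact p.Prime]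
      (N : ℕ) [NeZero N] (K : Type) [Field K] [NumberField K]
      (Dt : ModularParametrizationData W N) (H : HeegnerDatum N (NumberField.discr K)) (ι : K →+* ℂ)
      (P : (W.baseChange K).toAffine.Point),
      ClassX11b W p → Ram W p → W.conductorNorm ℤ = N → IsImaginaryQuadratic K →
      SatisfiesHeegnerHypothesis N K →
      WeierstrassCurve.Affine.Point.map ι.toRatAlgHom P = heegnerPointComplex Dt H →
      ¬ (p : ℤ) ∣ Dt.c → IndexLowerBoundAt W p K P)
    (W : WeierstrassCurve ℚ) [W.IsElliptic] [W.IsGloballyMinimal] (hX : IsX11Three W)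
    (hram : Ram W 3) (q : ℕ) [Fact q.Prime] (hqN : q ∣ W.conductorNorm ℤ)
    (hmono : padicValNat 3 W.tamagawaProduct ≤
      padicValNat 3 ((W.baseChange ℚ_[q]).localTamagawaNumber ℤ_[q])) :
    BSDp W 3 :=
  haveI : Fact (Nat.Prime 3) := ⟨by norm_num⟩
  bsdp_of_classX11b_of_ram_of_monoCarrier 3 hGZ hKo hSk hGZK hmod hnf hHL hMaz hNS hJ hL W
    (classX11b_three_of_isX11Three W hX) hram q hqN hmono

/-- **X11b at `p = 3`, rank one, (ram), ANY Tamagawa numbers: Jetchev's residual defect at `3`**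
modulo the reading — for every prime `q ∣ N_E`, `#Ш(E)_an = r ∈ ℚ` with
`ord_3 #Ш(E) + 2·ord_3 c_q(E) ≤ ord_3 r + 2·ord_3 ∏_ℓ c_ℓ(E)`. On the multi-carrier pairs of (T2′)@3
this is all the Jetchev road gives. Nothing booked.
[claim: Jetchev2008, status: under-review]
[cite: Jetchev2008, Thm. 1.1 (p. 812) (shape only)] [cite: Miller2011LMS, Def. 1.1] -/
theorem IsX11Three.padicValNat_shaOrder_le_add_sub_of_ram
    -- published inputs (named facts of the tree)
    (hGZ : ∀ (N : ℕ) [NeZero N] (W : WeierstrassCurve ℚ) (K : Type) [Field K] [NumberField K],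
      gross_zagier N W K)
    (hKo : ∀ (N : ℕ) [NeZero N] (W : WeierstrassCurve ℚ) (K : Type) [Field K] [NumberField K],
      kolyvagin N W K)
    (hSk : Skinner2016.thmC_padicValRat_bsd_rank_zero)
    (hGZK : rank_eq_analyticRank_of_analyticRank_le_one) (hmod : hasEntireLFunction_rat)
    (hnf : exists_isNewformOf) (hHL : HoffsteinLuo1997_exists_twist_L_one_ne_zero)
    (hMaz : mazur_not_dvd_maninConstant_of_odd) (hNS : integral_neronScaling_of_isGloballyMinimal)
    (hJ : ∀ (N : ℕ) [NeZero N] (W : WeierstrassCurve ℚ) [W.IsElliptic] (K : Type) [Field K]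
      [NumberField K], IsImaginaryQuadratic K → SatisfiesHeegnerHypothesis N K →
      ∀ {P : (W.baseChange K).toAffine.Point}, IsHeegnerPoint N W K P → ¬ IsOfFinAddOrder P →
      3 ∣ N → W.HasSurjectiveModNGaloisRep 3 → ∀ (q : ℕ) [Fact q.Prime], q ∣ N →
      padicValNat 3 (Nat.card (W.baseChange K).sha) +
          2 * padicValNat 3 ((W.baseChange ℚ_[q]).localTamagawaNumber ℤ_[q]) ≤
        2 * padicValNat 3 (AddSubgroup.zmultiples P).index)
    (W : WeierstrassCurve ℚ) [W.IsElliptic] [W.IsGloballyMinimal] (hX : IsX11Three W)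
    (hram : Ram W 3) (q : ℕ) [Fact q.Prime] (hqN : q ∣ W.conductorNorm ℤ) :
    ∃ r : ℚ, shaAn W = (r : ℂ) ∧
      (padicValNat 3 W.shaOrder : ℤ) +
          2 * padicValNat 3 ((W.baseChange ℚ_[q]).localTamagawaNumber ℤ_[q]) ≤
        padicValRat 3 r + 2 * padicValNat 3 W.tamagawaProduct :=
  haveI : Fact (Nat.Prime 3) := ⟨by norm_num⟩
  padicValNat_shaOrder_le_add_sub_of_classX11b_of_ram 3 hGZ hKo hSk hGZK hmod hnf hHL hMaz hNS hJ W
    (classX11b_three_of_isX11Three W hX) hram q hqN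

/-- **The same upper-half row with the class predicate `ClassX11b W 3`** (route p2's vocabulary; for
p3's whole-class assembly `X11b/Three/TamagawaAtomClass.lean`, whose (T2α/β/γ)@3 binders this
replaces on the mono-carrier sub-atom modulo the reading). Nothing booked.
[claim: Jetchev2008, status: under-review]
[cite: Jetchev2008, Thm. 1.1 (p. 812) (shape only)] [cite: Miller2011LMS, Def. 1.1] -/
theorem ClassX11b.missingUpperBoundAt_three_of_ram_of_monoCarrier
    (hGZ : ∀ (N : ℕ) [NeZero N] (W : WeierstrassCurve ℚ) (K : Type) [Field K] [NumberField K],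
      gross_zagier N W K)
    (hKo : ∀ (N : ℕ) [NeZero N] (W : WeierstrassCurve ℚ) (K : Type) [Field K] [NumberField K],
      kolyvagin N W K)
    (hSk : Skinner2016.thmC_padicValRat_bsd_rank_zero)
    (hGZK : rank_eq_analyticRank_of_analyticRank_le_one) (hmod : hasEntireLFunction_rat)
    (hnf : exists_isNewformOf) (hHL : HoffsteinLuo1997_exists_twist_L_one_ne_zero)
    (hMaz : mazur_not_dvd_maninConstant_of_odd) (hNS : integral_neronScaling_of_isGloballyMinimal)
    (hJ : ∀ (N : ℕ) [NeZero N] (W : WeierstrassCurve ℚ) [W.IsElliptic] (K : Type) [Field K]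
      [NumberField K], IsImaginaryQuadratic K → SatisfiesHeegnerHypothesis N K →
      ∀ {P : (W.baseChange K).toAffine.Point}, IsHeegnerPoint N W K P → ¬ IsOfFinAddOrder P →
      3 ∣ N → W.HasSurjectiveModNGaloisRep 3 → ∀ (q : ℕ) [Fact q.Prime], q ∣ N →
      padicValNat 3 (Nat.card (W.baseChange K).sha) +
          2 * padicValNat 3 ((W.baseChange ℚ_[q]).localTamagawaNumber ℤ_[q]) ≤
        2 * padicValNat 3 (AddSubgroup.zmultiples P).index)
    (W : WeierstrassCurve ℚ) [W.IsElliptic] [W.IsGloballyMinimal] (hX : ClassX11b W 3)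
    (hram : Ram W 3) (q : ℕ) [Fact q.Prime] (hqN : q ∣ W.conductorNorm ℤ)
    (hmono : padicValNat 3 W.tamagawaProduct ≤
      padicValNat 3 ((W.baseChange ℚ_[q]).localTamagawaNumber ℤ_[q])) :
    Typed.MissingUpperBoundAt W 3 :=
  haveI : Fact (Nat.Prime 3) := ⟨by norm_num⟩
  missingUpperBoundAt_of_classX11b_of_ram_of_monoCarrier 3 hGZ hKo hSk hGZK hmod hnf hHL hMaz hNS hJ W
    hX hram q hqN hmono

end Three

end Summit.BirchSwinnertonDyer.Rank1Residual.X11b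

end
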